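import Summits.BirchSwinnertonDyer.BirchSwinnertonDyer.Theorems.EisensteinDepletionAtTwoStarOptBNSFX1Transfer
import Literature.NumberTheory.EllipticCurves.ModularParamXFunction
import HarnessLib

/-!
# A `Γ₁(N)`-presentation of `℘_{Λ″}(2πi∫f)` with a prescribed `Γ₀(N)`-denominator (line `nsf` v21, stub S3-X `stub_x1Denominator`, part X-b; crux `StarOptBNSF`, stmt-BirchSwinnertonDyer-27047)

Let `f ∈ S₂(Γ₀(N))`, `f ≠ 0`, `u = 2πi∫f`, and let `Λ″ ⊆ Λ′` be lattices with `Λ₁(f) ⊆ Λ″` (so `x″ = ℘_{Λ″}(u)` is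
`Γ₁(N)`-invariant) and `(F, G)` a `Γ₀(N)`-presentation of `x′ = ℘_{Λ′}(u)` (`IsXPresentation f L′ F G`).  The poles of
`x″` are among those of `x′` with the same order `2·ord(u − u(τ))`, so `G` kills them on `ℍ` (`orderAt_add_eq_of_mem`); a power
`f^a` kills them at every cusp (`isZeroAtImInfty_slash_of_presentation_mul_pow`, `a = 1 + Σ_r (2m_r + 1)` over coset
representatives of `Γ₁(N)`).  Hence (`exists_gamma1_presentation`): **there are `a` and cusp forms
`G₁, Φ ∈ S_{k+2a}(Γ₁(N))` with `G₁ = G·f^a` and `Φ(τ) = ℘_{Λ″}(u(τ))·G₁(τ)` off the poles of `x″`** — the holomorphic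
extension is `exists_invariant_extension_gamma1`.  With `G` RATIONAL (previous file `…X1RatPres`) this is the rational
`Γ₁(N)`-denominator of the `X₁(N)`-parametrisation.
Nothing here reads `r_an`; BSD is not proved by this file.
-/

set_option linter.dupNamespace false
set_option autoImplicit false

noncomputable section

open Complex Filter Topology Set Function
open UpperHalfPlane hiding I
open scoped Real Topology Manifold MatrixGroups PeriodPair ModularForm
open ModularForm CongruenceSubgroup

open Literature.NumberTheory.EllipticCurves Literature.NumberTheory.EllipticCurves.ModularForms
open Summit.BirchSwinnertonDyer.BirchSwinnertonDyer.Theorems.DepletionAtTwo.X1Transfer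

namespace Summit.BirchSwinnertonDyer.BirchSwinnertonDyer.Theorems.DepletionAtTwo.X1Gamma1Pres

variable {N : ℕ} [NeZero N]

omit [NeZero N] in
/-- Weight bookkeeping: `(G·f^a)(γτ) = (cτ+d)^{k+2a}(G·f^a)(τ)` for `γ ∈ Γ₀(N)`. [folklore] -/
theorem mul_pow_apply_smul {k : ℤ} (G : CuspForm (Gamma0 N) k) (f : CuspForm (Gamma0 N) 2) (a : ℕ)
    {γ : SL(2, ℤ)} (hγ : γ ∈ Gamma0 N) (τ : ℍ) :
    G (γ • τ) * f (γ • τ) ^ a = denom γ τ ^ (k + 2 * (a : ℤ)) * (G τ * f τ ^ a) := by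
  have hd0 : denom γ τ ≠ 0 := denom_ne_zero γ τ
  rw [SlashInvariantForm.slash_action_eqn_SL'' G hγ τ, SlashInvariantForm.slash_action_eqn_SL'' f hγ τ, mul_pow,
    ← zpow_natCast (denom γ τ ^ (2 : ℤ)) a, ← zpow_mul, zpow_add₀ hd0]
  ring

omit [NeZero N] in
/-- `(G·f^a) ∣[k+2a] A = (G∣[k]A)·(f∣[2]A)^a` pointwise, for any `A ∈ SL(2, ℤ)`. [folklore] -/
theorem mul_pow_slash_apply {k : ℤ} (G : CuspForm (Gamma0 N) k) (f : CuspForm (Gamma0 N) 2) (a : ℕ)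
    (A : SL(2, ℤ)) (τ : ℍ) :
    ((fun τ : ℍ ↦ G τ * f τ ^ a) ∣[k + 2 * (a : ℤ)] A) τ = ((⇑G) ∣[k] A) τ * (((⇑f) ∣[(2 : ℤ)] A) τ) ^ a := by
  have hd0 : denom A τ ≠ 0 := denom_ne_zero A τ
  simp only [ModularForm.SL_slash_apply]
  rw [show -(k + 2 * (a : ℤ)) = -k + (-2 : ℤ) * a by ring, zpow_add₀ hd0, zpow_mul, zpow_natCast, mul_pow]
  ring

/-- **A `Γ₁(N)`-presentation of `℘_{Λ″}(u)` with denominator `G·f^a`.**  See the file docstring.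
[cite: ShimuraIATAF1971, §2.4 and Thm. 7.14] -/
theorem exists_gamma1_presentation (f : CuspForm (Gamma0 N) 2) (hf : f ≠ 0) (L'' L' : PeriodPair)
    (hΛ₁ : ∀ x ∈ periodLatticeGamma1 f, x ∈ L''.lattice) (hsub : ∀ v ∈ L''.lattice, v ∈ L'.lattice)
    {k : ℤ} {F G : CuspForm (Gamma0 N) k} (hpres : IsXPresentation f L' F G) :
    ∃ (a : ℕ) (G₁ Φ : CuspForm (Gamma1 N) (k + 2 * (a : ℤ))), 1 ≤ a ∧
      (∀ τ : ℍ, G₁ τ = G τ * f τ ^ a) ∧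
      (∀ τ : ℍ, eichlerIntegral f τ ∉ L''.lattice → Φ τ = ℘[L''] (eichlerIntegral f τ) * G₁ τ) := by
  classical
  -- exponents from the cusps of `Γ₁(N)`
  obtain ⟨R, hR⟩ := exists_finset_mul_cover (Gamma1 N)
  set m : SL(2, ℤ) → ℕ := fun r ↦
    analyticOrderNatAt (cuspFunction N (verticalIntegral (⇑f ∣[(2 : ℤ)] r))) 0 with hm
  set a : ℕ := 1 + ∑ r ∈ R, (2 * m r + 1) with ha
  have ha1 : 1 ≤ a := Nat.le_add_right _ _
  have haR : ∀ r ∈ R, 2 * m r + 1 ≤ a := fun r hr ↦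
    (Finset.single_le_sum (f := fun r ↦ 2 * m r + 1) (fun _ _ ↦ Nat.zero_le _) hr).trans
      (Nat.le_add_left _ _)
  set K : ℤ := k + 2 * (a : ℤ) with hK
  set Gs : ℍ → ℂ := fun τ ↦ G τ * f τ ^ a with hGs
  set H : Set ℂ := {z : ℂ | 0 < z.im} with hH
  -- analytic data of `G·f^a`
  have hGc : AnalyticOnNhd ℂ ((⇑G) ∘ ofComplex) H :=
    (UpperHalfPlane.mdifferentiable_iff.mp G.holo').analyticOnNhd isOpen_upperHalfPlaneSet
  have hfc : AnalyticOnNhd ℂ ((⇑f) ∘ ofComplex) H :=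
    (UpperHalfPlane.mdifferentiable_iff.mp f.holo').analyticOnNhd isOpen_upperHalfPlaneSet
  have hGsc : (Gs ∘ ofComplex) = ((⇑G) ∘ ofComplex) * ((⇑f) ∘ ofComplex) ^ a := by
    funext z; simp [hGs]
  have hGsan : AnalyticOnNhd ℂ (Gs ∘ ofComplex) H := by
    rw [hGsc]; exact fun z hz ↦ (hGc z hz).mul ((hfc z hz).pow a)
  have hGsmul : ∀ (γ : SL(2, ℤ)), γ ∈ Gamma1 N → ∀ τ : ℍ, Gs (γ • τ) = denom γ τ ^ K * Gs τ :=
    fun γ hγ τ ↦ mul_pow_apply_smul G f a (Gamma1_in_Gamma0 N hγ) τ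
  -- `G·f^a` kills the poles of `℘_{Λ″}(u)`
  have hG0 : (G : ModularForm (Gamma0 N) k) ≠ 0 := hpres.modularForm_ne_zero
  have hkill : ∀ z : ℂ, 0 < z.im → eichlerIntegral f (ofComplex z) ∈ L''.lattice →
      0 ≤ meromorphicOrderAt ((fun w : ℂ ↦ ℘[L''] (eichlerIntegral f (ofComplex w))) *
        (Gs ∘ ofComplex)) z := by
    intro z hz hzL
    set τ : ℍ := ⟨z, hz⟩ with hτ
    have hzτ : ofComplex z = τ := ofComplex_apply_of_im_pos hz
    have hτL' : eichlerIntegral f τ ∈ L'.lattice := hsub _ (by rwa [hzτ] at hzL)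
    have hord := meromorphicOrderAt_weierstrassP_eichlerIntegral f hf L'' hz hzL
    have hpole := hpres.orderAt_add_eq_of_mem hf hτL'
    have hGord : ((2 * IsXPresentation.poleOrder f τ : ℕ) : ℕ∞) ≤ analyticOrderAt (Gs ∘ ofComplex) z := by
      rw [hGsc, analyticOrderAt_mul (hGc z hz) ((hfc z hz).pow a)]
      have h1 : ((orderAt (G : ModularForm (Gamma0 N) k) τ : ℕ) : ℕ∞) =
          analyticOrderAt ((⇑G) ∘ ofComplex) z := by
        rw [orderAt_eq hG0 τ]; rfl
      calc ((2 * IsXPresentation.poleOrder f τ : ℕ) : ℕ∞) ≤ (orderAt (G : ModularForm (Gamma0 N) k) τ : ℕ∞) := by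
            exact_mod_cast (by omega : 2 * IsXPresentation.poleOrder f τ ≤ orderAt (G : ModularForm (Gamma0 N) k) τ)
        _ = analyticOrderAt ((⇑G) ∘ ofComplex) z := h1
        _ ≤ analyticOrderAt ((⇑G) ∘ ofComplex) z + analyticOrderAt (((⇑f) ∘ ofComplex) ^ a) z :=
            le_self_add
    refine meromorphicOrderAt_mul_nonneg_of_natCast_le (meromorphicAt_weierstrassP_eichlerIntegral f L'' hz)
      hord ?_ (hGsan z hz) hGord
    simp only [IsXPresentation.poleOrder, hτ, UpperHalfPlane.coe_mk]
    push_cast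
    omega
  -- the holomorphic `Γ₁(N)`-invariant extension
  obtain ⟨Φf, hΦmd, hΦslash, hΦeq⟩ :=
    exists_invariant_extension_gamma1 f hf L'' hΛ₁ Gs K hGsan hGsmul hkill
  -- cusp decay
  have hΦzero : ∀ B : SL(2, ℤ), IsZeroAtImInfty (Φf ∣[K] B) := by
    intro B
    obtain ⟨γ, hγ, r, hr, rfl⟩ := hR B
    rw [SlashAction.slash_mul, hΦslash γ hγ]
    exact isZeroAtImInfty_slash_of_presentation_mul_pow f hf L'' Φf G a r
      (fun τ hτ ↦ hΦeq τ hτ) (haR r hr)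
  have hGszero : ∀ B : SL(2, ℤ), IsZeroAtImInfty (Gs ∣[K] B) := by
    intro B
    have h1 : Tendsto ((⇑G) ∣[k] B) atImInfty (𝓝 0) := CuspFormClass.zero_at_infty_slash G B
    have h2 : Tendsto ((⇑f) ∣[(2 : ℤ)] B) atImInfty (𝓝 0) := CuspFormClass.zero_at_infty_slash f B
    have h3 := h1.mul (h2.pow a)
    rw [zero_mul] at h3
    refine (h3.congr' (Eventually.of_forall fun τ ↦ ?_) : Tendsto (Gs ∣[K] B) atImInfty (𝓝 0))
    exact (mul_pow_slash_apply G f a B τ).symm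
  have hGsslash : ∀ γ : SL(2, ℤ), γ ∈ Gamma1 N → Gs ∣[K] γ = Gs := by
    intro γ hγ
    funext τ
    have hd0 : denom γ τ ≠ 0 := denom_ne_zero γ τ
    rw [ModularForm.SL_slash_apply, hGsmul γ hγ τ, zpow_neg, mul_comm (denom γ τ ^ K) _, mul_assoc,
      mul_inv_cancel₀ (zpow_ne_zero _ hd0), mul_one]
  have hGsmd : MDifferentiable 𝓘(ℂ) 𝓘(ℂ) Gs := by
    rw [UpperHalfPlane.mdifferentiable_iff]
    exact hGsan.differentiableOn
  -- the two cusp forms on `Γ₁(N)`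
  let G₁ : CuspForm (Gamma1 N) K :=
    { toFun := Gs
      slash_action_eq' := fun A hA ↦ by
        obtain ⟨γ, hγ, rfl⟩ := hA
        exact hGsslash γ hγ
      holo' := hGsmd
      zero_at_cusps' := fun {c} hc ↦ by
        rw [Subgroup.IsArithmetic.isCusp_iff_isCusp_SL2Z] at hc
        rw [OnePoint.isZeroAt_iff_forall_SL2Z hc]
        intro B _
        exact hGszero B }
  let Φ : CuspForm (Gamma1 N) K :=
    { toFun := Φf
      slash_action_eq' := fun A hA ↦ by
        obtain ⟨γ, hγ, rfl⟩ := hA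
        exact hΦslash γ hγ
      holo' := hΦmd
      zero_at_cusps' := fun {c} hc ↦ by
        rw [Subgroup.IsArithmetic.isCusp_iff_isCusp_SL2Z] at hc
        rw [OnePoint.isZeroAt_iff_forall_SL2Z hc]
        intro B _
        exact hΦzero B }
  refine ⟨a, G₁, Φ, ha1, fun τ ↦ rfl, fun τ hτ ↦ ?_⟩
  exact (hΦeq τ hτ).symm

end Summit.BirchSwinnertonDyer.BirchSwinnertonDyer.Theorems.DepletionAtTwo.X1Gamma1Pres

end
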